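import Summits.Ventures.HodgeRepro2.T5LocalHermitian

/-!
# T5UnipotentCommutator — the unipotent radical of the Borel of U(ℍ) lies in the commutator
subgroup, so every character of U(ℍ) is trivial on it (cell pub-hodge-repro2, seat p3)

This closes the one prose step left inside the kernel chain of `T5SplittingTwist` (p391837) for
the rank-one quasi-split unitary group: `coinvariantsKer_twist_of_le_commutator` there needs
`N ≤ [G, G]` for the unipotent radical `N` of a parabolic; here `G = U(ℍ)`, the unitary group of
the hyperbolic plane `ℍ = !![0, 1; 1, 0]` (T5LocalHermitian `hyperbolicPlane`) over a field `E`
with a star (the conjugation of `E/F`), and `N = {u(x) = !![1, x; 0, 1] : x̄ = -x}`.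

* `hypUnitary E : Subgroup (GL (Fin 2) E)` — `{g | gᴴ ℍ g = ℍ}`.
* `unip x`, `unipUnit x` (`x̄ = -x`) and `diagUnit t` (`t ≠ 0`, `d(t) = diag(t, t̄⁻¹)`) lie in it
  (`unipUnit_mem_hypUnitary`, `diagUnit_mem_hypUnitary`).
* `commutator_diagUnit_unipUnit`: `⁅d(t), u(x)⁆ = u((t t̄ - 1) x)`.
* `unip_mem_commutator`: if some `t ≠ 0` has `t t̄ ≠ 1` (every local field: `t ∈ F^×`, `t² ≠ 1`),
  every `u(y)` with `ȳ = -y` lies in `commutator (hypUnitary E)`.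
* `character_unip_eq_one`: hence every character `χ : hypUnitary E →* A` (`A` commutative) is
  trivial on the unipotent elements.

Honest scope: `2 × 2` matrices over an abstract star-field; that MVW's parabolic `P′₁` of `U(ℍ)`
is this Borel with this unipotent radical is the prose of T5-SUPPORT-p3 §14(d) (Q-7).
Standard axioms.
-/

namespace Summit.Ventures.HodgeRepro2.T5UnipotentCommutator

open Matrix
open scoped commutatorElement

variable {E : Type*} [Field E] [StarRing E]

/-- The hyperbolic plane `ℍ = !![0, 1; 1, 0]` (reused from `T5LocalHermitian`). -/
abbrev hyp : Matrix (Fin 2) (Fin 2) E := T5LocalHermitian.hyperbolicPlane E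

omit [StarRing E] in
/-- `hyp = !![0, 1; 1, 0]`. -/
theorem hyp_eq : (hyp : Matrix (Fin 2) (Fin 2) E) = !![0, 1; 1, 0] := rfl

/-- Conjugate transpose of an explicit `2 × 2` matrix. -/
theorem conjTranspose_fin_two (a b c d : E) :
    (!![a, b; c, d])ᴴ = !![star a, star c; star b, star d] := by
  ext i j
  fin_cases i <;> fin_cases j <;> rfl

/-- The underlying matrix of an element of `GL₂(E)`. -/
abbrev mat (g : GL (Fin 2) E) : Matrix (Fin 2) (Fin 2) E := g

omit [StarRing E] in
/-- `mat (g * h) = mat g * mat h`. -/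
theorem mat_mul (g h : GL (Fin 2) E) : mat (g * h) = mat g * mat h := rfl

omit [StarRing E] in
/-- `mat g * mat g⁻¹ = 1`. -/
theorem mat_mul_inv (g : GL (Fin 2) E) : mat g * mat g⁻¹ = 1 := by
  rw [← mat_mul, mul_inv_cancel]
  rfl

omit [StarRing E] in
/-- `mat g⁻¹ * mat g = 1`. -/
theorem mat_inv_mul (g : GL (Fin 2) E) : mat g⁻¹ * mat g = 1 := by
  rw [← mat_mul, inv_mul_cancel]
  rfl

variable (E) in
/-- The unitary group of the hyperbolic plane: `{g | gᴴ ℍ g = ℍ}` inside `GL₂(E)`. -/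
def hypUnitary : Subgroup (GL (Fin 2) E) where
  carrier := {g | (mat g)ᴴ * hyp * mat g = hyp}
  one_mem' := by
    show (mat 1)ᴴ * hyp * mat 1 = hyp
    simp [mat]
  mul_mem' := by
    intro g h hg hh
    simp only [Set.mem_setOf_eq] at hg hh ⊢
    calc (mat (g * h))ᴴ * hyp * mat (g * h)
        = (mat h)ᴴ * ((mat g)ᴴ * hyp * mat g) * mat h := by
          rw [mat_mul, conjTranspose_mul]
          simp only [Matrix.mul_assoc]
      _ = hyp := by rw [hg, hh]
  inv_mem' := by
    intro g hg
    simp only [Set.mem_setOf_eq] at hg ⊢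
    have h1 : (mat g⁻¹)ᴴ * (mat g)ᴴ = 1 := by
      rw [← conjTranspose_mul, mat_mul_inv, conjTranspose_one]
    calc (mat g⁻¹)ᴴ * hyp * mat g⁻¹
        = (mat g⁻¹)ᴴ * ((mat g)ᴴ * hyp * mat g) * mat g⁻¹ := by rw [hg]
      _ = ((mat g⁻¹)ᴴ * (mat g)ᴴ) * hyp * (mat g * mat g⁻¹) := by
          simp only [Matrix.mul_assoc]
      _ = hyp := by rw [h1, mat_mul_inv, Matrix.one_mul, Matrix.mul_one]

/-- Membership in `hypUnitary`. -/
theorem mem_hypUnitary_iff (g : GL (Fin 2) E) :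
    g ∈ hypUnitary E ↔ (mat g)ᴴ * hyp * mat g = hyp := Iff.rfl

/-! ## Unipotent and diagonal elements -/

/-- The unipotent matrix `u(x) = !![1, x; 0, 1]`. -/
def unip (x : E) : Matrix (Fin 2) (Fin 2) E := !![1, x; 0, 1]

omit [StarRing E] in
/-- `u(x) u(y) = u(x + y)`. -/
theorem unip_mul (x y : E) : unip x * unip y = unip (x + y) := by
  simp [unip, add_comm]

omit [StarRing E] in
/-- `u(0) = 1`. -/
theorem unip_zero : unip (0 : E) = 1 := by
  simp [unip, Matrix.one_fin_two]

/-- `u(x)` as an element of `GL₂(E)`, with inverse `u(-x)`. -/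
def unipUnit (x : E) : GL (Fin 2) E where
  val := unip x
  inv := unip (-x)
  val_inv := by rw [unip_mul, add_neg_cancel, unip_zero]
  inv_val := by rw [unip_mul, neg_add_cancel, unip_zero]

omit [StarRing E] in
/-- The underlying matrix of `unipUnit x`. -/
@[simp]
theorem unipUnit_val (x : E) : mat (unipUnit x) = unip x := rfl

omit [StarRing E] in
/-- The inverse of `unipUnit x` is `unipUnit (-x)`. -/
theorem unipUnit_inv (x : E) : (unipUnit x)⁻¹ = unipUnit (-x) := by
  ext : 1
  rfl

omit [StarRing E] in
/-- `unipUnit` is a homomorphism from `(E, +)`. -/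
theorem unipUnit_mul (x y : E) : unipUnit x * unipUnit y = unipUnit (x + y) := by
  ext : 1
  simp [unip_mul]

/-- `u(x) ∈ U(ℍ)` if and only if `x̄ = -x`. -/
theorem unipUnit_mem_hypUnitary_iff (x : E) : unipUnit x ∈ hypUnitary E ↔ star x = -x := by
  rw [mem_hypUnitary_iff, unipUnit_val, unip, hyp_eq, conjTranspose_fin_two, Matrix.mul_fin_two,
    Matrix.mul_fin_two]
  simp only [star_one, star_zero, mul_zero, mul_one, zero_mul, one_mul, add_zero, zero_add]
  constructor
  · intro h
    have := congrFun (congrFun h 1) 1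
    simp at this
    linear_combination this
  · intro h
    simp [h]

/-- `u(x) ∈ U(ℍ)` for `x̄ = -x`. -/
theorem unipUnit_mem_hypUnitary (x : E) (hx : star x = -x) : unipUnit x ∈ hypUnitary E :=
  (unipUnit_mem_hypUnitary_iff x).mpr hx

/-- The diagonal matrix `d(t) = diag(t, t̄⁻¹)`. -/
def diag (t : E) : Matrix (Fin 2) (Fin 2) E := !![t, 0; 0, (star t)⁻¹]

/-- `d(t)` as an element of `GL₂(E)` (`t ≠ 0`), with inverse `diag(t⁻¹, t̄)`. -/
def diagUnit (t : E) (ht : t ≠ 0) : GL (Fin 2) E where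
  val := diag t
  inv := !![t⁻¹, 0; 0, star t]
  val_inv := by
    have hs : star t ≠ 0 := star_ne_zero.mpr ht
    simp [diag, Matrix.one_fin_two, mul_inv_cancel₀ ht, inv_mul_cancel₀ hs]
  inv_val := by
    have hs : star t ≠ 0 := star_ne_zero.mpr ht
    simp [diag, Matrix.one_fin_two, inv_mul_cancel₀ ht, mul_inv_cancel₀ hs]

/-- The underlying matrix of `diagUnit t`. -/
@[simp]
theorem diagUnit_val (t : E) (ht : t ≠ 0) : mat (diagUnit t ht) = diag t := rfl

/-- The underlying matrix of `(diagUnit t)⁻¹`. -/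
@[simp]
theorem diagUnit_inv_val (t : E) (ht : t ≠ 0) :
    mat (diagUnit t ht)⁻¹ = !![t⁻¹, 0; 0, star t] := rfl

/-- `d(t) ∈ U(ℍ)`. -/
theorem diagUnit_mem_hypUnitary (t : E) (ht : t ≠ 0) : diagUnit t ht ∈ hypUnitary E := by
  have hs : star t ≠ 0 := star_ne_zero.mpr ht
  rw [mem_hypUnitary_iff, diagUnit_val, diag, hyp_eq, conjTranspose_fin_two, Matrix.mul_fin_two,
    Matrix.mul_fin_two]
  simp [star_star, star_inv₀, mul_inv_cancel₀ hs, inv_mul_cancel₀ ht]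

/-! ## The commutator identity -/

/-- `d(t) u(x) d(t)⁻¹ = u(t t̄ x)`. -/
theorem diagUnit_mul_unipUnit_mul_inv (t : E) (ht : t ≠ 0) (x : E) :
    diagUnit t ht * unipUnit x * (diagUnit t ht)⁻¹ = unipUnit (t * star t * x) := by
  have hs : star t ≠ 0 := star_ne_zero.mpr ht
  ext : 1
  show mat (diagUnit t ht * unipUnit x * (diagUnit t ht)⁻¹) = mat (unipUnit (t * star t * x))
  simp only [mat_mul, diagUnit_val, unipUnit_val, diagUnit_inv_val, diag, unip,
    Matrix.mul_fin_two]
  simp [inv_mul_cancel₀ hs, mul_inv_cancel₀ ht, mul_assoc, mul_comm, mul_left_comm]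

/-- The commutator `⁅d(t), u(x)⁆ = u((t t̄ - 1) x)`. -/
theorem commutator_diagUnit_unipUnit (t : E) (ht : t ≠ 0) (x : E) :
    ⁅diagUnit t ht, unipUnit x⁆ = unipUnit ((t * star t - 1) * x) := by
  rw [commutatorElement_def, diagUnit_mul_unipUnit_mul_inv, unipUnit_inv, unipUnit_mul]
  congr 1
  ring

/-- `t t̄` is fixed by the star. -/
theorem star_mul_star_self (t : E) : star (t * star t) = t * star t := by
  rw [star_mul, star_star, mul_comm]

/-- `x̄ = -x` is preserved by division by an element fixed by the star. -/
theorem star_div_eq_neg (x c : E) (hx : star x = -x) (hc : star c = c) :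
    star (x / c) = -(x / c) := by
  rw [star_div₀, hx, hc, neg_div]

/-! ## The unipotent radical lies in the commutator subgroup -/

/-- If some `t ≠ 0` has `t t̄ ≠ 1`, every unipotent `u(y)` with `ȳ = -y` is a commutator of two
elements of `U(ℍ)`: `u(y) = ⁅d(t), u(y / (t t̄ - 1))⁆`. -/
theorem unipUnit_eq_commutator (t : E) (ht : t ≠ 0) (ht1 : t * star t ≠ 1) (y : E) :
    unipUnit y = ⁅diagUnit t ht, unipUnit (y / (t * star t - 1))⁆ := by
  have hc : t * star t - 1 ≠ 0 := sub_ne_zero.mpr ht1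
  have h : (t * star t - 1) * (y / (t * star t - 1)) = y := by field_simp
  rw [commutator_diagUnit_unipUnit, h]

/-- The unipotent element `u(y)` (`ȳ = -y`), viewed in the subgroup `U(ℍ)`, lies in the commutator
subgroup of `U(ℍ)` as soon as some `t ≠ 0` has `t t̄ ≠ 1`. -/
theorem unip_mem_commutator (t : E) (ht : t ≠ 0) (ht1 : t * star t ≠ 1) (y : E)
    (hy : star y = -y) :
    (⟨unipUnit y, unipUnit_mem_hypUnitary y hy⟩ : hypUnitary E) ∈ commutator (hypUnitary E) := by
  have hc : star (t * star t - 1) = t * star t - 1 := by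
    rw [star_sub, star_mul_star_self, star_one]
  have hx : star (y / (t * star t - 1)) = -(y / (t * star t - 1)) := star_div_eq_neg _ _ hy hc
  have hd : diagUnit t ht ∈ hypUnitary E := diagUnit_mem_hypUnitary t ht
  have hu : unipUnit (y / (t * star t - 1)) ∈ hypUnitary E := unipUnit_mem_hypUnitary _ hx
  have heq : (⟨unipUnit y, unipUnit_mem_hypUnitary y hy⟩ : hypUnitary E) =
      ⁅(⟨diagUnit t ht, hd⟩ : hypUnitary E), ⟨unipUnit (y / (t * star t - 1)), hu⟩⁆ := by
    apply Subtype.ext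
    have h := unipUnit_eq_commutator t ht ht1 y
    rw [commutatorElement_def] at h
    rw [commutatorElement_def, Subgroup.coe_mul, Subgroup.coe_mul, Subgroup.coe_mul,
      Subgroup.coe_inv, Subgroup.coe_inv]
    exact h
  rw [heq]
  exact Subgroup.commutator_mem_commutator (Subgroup.mem_top _) (Subgroup.mem_top _)

/-- Every character of `U(ℍ)` with values in a commutative group is trivial on the unipotent
elements `u(y)`, `ȳ = -y` (given some `t ≠ 0` with `t t̄ ≠ 1`). -/
theorem character_unip_eq_one {A : Type*} [CommGroup A] (χ : hypUnitary E →* A)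
    (t : E) (ht : t ≠ 0) (ht1 : t * star t ≠ 1) (y : E) (hy : star y = -y) :
    χ ⟨unipUnit y, unipUnit_mem_hypUnitary y hy⟩ = 1 :=
  MonoidHom.mem_ker.mp
    (Abelianization.commutator_subset_ker χ (unip_mem_commutator t ht ht1 y hy))

/-- A star-fixed `t` with `t² ≠ 1` supplies the hypothesis `t t̄ ≠ 1` (`t ∈ F^×`, `t² ≠ 1`). -/
theorem norm_ne_one_of_fixed (t : E) (hst : star t = t) (ht2 : t * t ≠ 1) :
    t * star t ≠ 1 := by
  rw [hst]
  exact ht2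

/-- `t = 2` (fixed by the star) has `t t̄ = 4 ≠ 1` as soon as `3 ≠ 0` in `E`. -/
theorem two_mul_star_two_ne_one (h3 : (3 : E) ≠ 0) :
    (2 : E) * star (2 : E) ≠ 1 := by
  rw [star_ofNat]
  intro h
  have : (3 : E) = 0 := by linear_combination h
  exact h3 this

end Summit.Ventures.HodgeRepro2.T5UnipotentCommutator
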